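import Literature.Probability.LatticeModels.DisorderedXYModel
import Literature.Probability.LatticeModels.GinibreInequality
import HarnessLib

/-!
# The Messager–Miracle-Solé–Pfister inequality: random bond phases lower XY correlations

A. Messager, S. Miracle-Solé, C. Pfister, *Correlation inequalities and uniqueness of the
equilibrium state for the plane rotator ferromagnetic model*, Comm. Math. Phys. **58** (1978)
19–29, extend Ginibre's inequalities for the plane rotator; the consequence used by
Garban–Spencer (J. Math. Phys. 63 (2022) 093302 = arXiv:2109.01617, Remark 1 and Appendix,
Theorem 7.1, "following Messager et al.") is that *quenched bond phases can only lower the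
two-point function*: for the XY model `exp (β ∑_a cos(θ_{tgt a} − θ_{src a} + ω_a)) ∏ dθ` on any
finite bond system and any phases `u_a = e^{iω_a}`,

  `⟨cos(θ(x) − θ(y))⟩_{u≡1,β} ≥ ⟨cos(θ(x) − θ(y))⟩_{u,β}`   (`β ≥ 0`).

This file PROVES it (`BondSystem.expect_cosDiff_le_expect_one`), in the slightly more general
form `⟨Re χ₀⟩_u ≤ ⟨Re χ₀⟩_1` for every continuous unitary character `χ₀` of the torus `U(1)^V`
(`BondSystem.expect_reChar_le_expect_one`), by the duplication argument printed in the source's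
Appendix, in the tree's Ginibre toolkit (`GinibreModel`, `GinibreInequality`,
`GinibrePositiveKernels`): with `θ = φψ⁻¹` (pure system) and `θ' = φψ` (system with phases
`u = v²`), `Z_1 Z_u (⟨Re χ₀⟩_1 − ⟨Re χ₀⟩_u) = ∫∫ (Re χ₀(θ) − Re χ₀(θ')) w_1(θ) w_u(θ') dθ dθ'`
(Fubini) `= ∫∫ 2 Im χ₀(φ) Im χ₀(ψ) exp (∑_a 2β Re(v_a χ_a(φ)) Re(v_a χ_a(ψ))) dφ dψ`
(the duplication map preserves `dθ dθ'`, `integral_comp_dupHom`; the identity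
`cos θ_a + cos(θ'_a − ω_a) = 2 cos(φ_a − ω_a/2) cos(φ'_a − ω_a/2)` of the source is
`mmp_exponent`), and the last integrand is a limit of positive kernels (`expTrunc`), hence has a
non-negative integral.

## References

* C. Garban, T. Spencer, J. Math. Phys. 63 (2022) 093302, arXiv:2109.01617: Remark 1 (p. 5 of
  the arXiv version) and Appendix "Correlation inequalities of Messager et al.", Theorem 7.1 with
  its proof. [GarbanSpencer2022]
* A. Messager, S. Miracle-Solé, C. Pfister, Comm. Math. Phys. 58 (1978) 19–29 (the original
  inequality; cited through the appendix of [GarbanSpencer2022]).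
* J. Ginibre, Comm. Math. Phys. 16 (1970) 310–328 (duplication method). [Ginibre1970]
-/

noncomputable section

open MeasureTheory Filter Finset TopologicalSpace
open scoped Topology BigOperators ComplexConjugate

namespace Literature.Probability.LatticeModels

/-! ### Characters of the torus `U(1)^V` -/

section Torus

variable {V : Type*}

/-- The relative-angle character `θ ↦ θ̄_x θ_y = e^{i(θ(y) − θ(x))}` of the torus `U(1)^V`, a
continuous unitary character. [folklore] -/
def diffChar (x y : V) : (V → Circle) →ₜ* Circle where
  toFun θ := (θ x)⁻¹ * θ y
  map_one' := by simp
  map_mul' θ θ' := by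
    simp only [Pi.mul_apply, mul_inv]
    exact mul_mul_mul_comm _ _ _ _
  continuous_toFun := ((continuous_apply x).inv).mul (continuous_apply y)

/-- `diffChar x y θ = θ̄_x θ_y`. [folklore] -/
@[simp] theorem diffChar_apply (x y : V) (θ : V → Circle) : diffChar x y θ = (θ x)⁻¹ * θ y := rfl

/-- The two-point observable is the real part of the relative-angle character:
`cos(θ(x) − θ(y)) = Re (θ̄_x θ_y)`. [folklore] -/
theorem cosDiff_eq_reChar (x y : V) (θ : V → Circle) :
    cosDiff x y θ = reChar (diffChar x y) θ := by
  rw [reChar, diffChar_apply, Circle.coe_mul, Circle.coe_inv_eq_conj, cosDiff]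

/-- Every element of the torus `U(1)^V` is a square (sitewise `e^{i arg/2}`), so Ginibre's
duplication map is onto. [folklore] -/
theorem surjective_mul_self_torus : Function.Surjective fun ψ : V → Circle => ψ * ψ := by
  intro θ
  refine ⟨fun v => Circle.exp (Complex.arg (θ v : ℂ) / 2), funext fun v => ?_⟩
  dsimp only [Pi.mul_apply]
  rw [← Circle.exp_add, add_halves, Circle.exp_arg]

end Torus

namespace BondSystem

variable {V ι : Type*} (G : BondSystem V ι)

/-! ### The bond characters of a bond system -/

/-- The bond character `χ_a(θ) = θ̄_{src a} θ_{tgt a} = Y_a(θ, 1)`. [folklore] -/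
def bondChar (a : ι) : (V → Circle) →ₜ* Circle :=
  diffChar (G.src a) (G.tgt a)

/-- `bondChar a θ = Y_a(θ, 1)`. [folklore] -/
theorem bondChar_apply (a : ι) (θ : V → Circle) : G.bondChar a θ = G.bondVar 1 θ a := by
  simp [bondChar, bondVar]

/-- `Y_a(θ, u) = u_a χ_a(θ)`. [folklore] -/
theorem bondVar_eq_mul_bondChar (u : ι → Circle) (θ : V → Circle) (a : ι) :
    G.bondVar u θ a = u a * G.bondChar a θ := by
  simp [bondChar, bondVar, mul_assoc]

/-! ### The duplicated integrand -/

section Exponent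

variable [Fintype ι]

/-- The MMP shifted cosine `k_a(θ) = Re (v_a χ_a(θ)) = cos(θ_{tgt a} − θ_{src a} + ω_a/2)` for a
square root `v_a` of the phase `u_a = e^{iω_a}`. [cite: GarbanSpencer2022, Appendix, proof of Theorem 7.1] -/
def mmpCos (v : ι → Circle) (a : ι) (θ : V → Circle) : ℝ :=
  ((v a : ℂ) * (G.bondChar a θ : ℂ)).re

omit [Fintype ι] in
/-- `k_a` is continuous. [folklore] -/
theorem continuous_mmpCos (v : ι → Circle) (a : ι) : Continuous (G.mmpCos v a) :=
  Complex.continuous_re.comp (continuous_const.mul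
    (continuous_subtype_val.comp (map_continuous (G.bondChar a))))

omit [Fintype ι] in
/-- `|k_a| ≤ 1`. [folklore] -/
theorem abs_mmpCos_le_one (v : ι → Circle) (a : ι) (θ : V → Circle) : |G.mmpCos v a θ| ≤ 1 := by
  refine (Complex.abs_re_le_norm _).trans ?_
  rw [norm_mul, Circle.norm_coe, Circle.norm_coe, mul_one]

/-- **The MMP exponent identity** `cos θ_a + cos(θ'_a − ω_a) = 2 cos(φ_a − ω_a/2) cos(φ'_a − ω_a/2)`
in group form: with `θ = φψ⁻¹`, `θ' = φψ` and `u = v²`,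
`∑_a Re Y_a(φψ⁻¹, 1) + ∑_a Re Y_a(φψ, u) = 2 ∑_a k_a(φ) k_a(ψ)`.
[cite: GarbanSpencer2022, Appendix, proof of Theorem 7.1] -/
theorem mmp_exponent (v : ι → Circle) (φ ψ : V → Circle) :
    G.energy 1 (φ * ψ⁻¹) + G.energy (fun a => v a * v a) (φ * ψ) =
      2 * ∑ a, G.mmpCos v a φ * G.mmpCos v a ψ := by
  simp only [energy, Finset.mul_sum, ← Finset.sum_add_distrib]
  refine Finset.sum_congr rfl fun a _ => ?_
  have key : ∀ A B : ℂ, (A * conj B).re + (A * B).re = 2 * (A.re * B.re) := by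
    intro A B; simp only [Complex.mul_re, Complex.conj_re, Complex.conj_im]; ring
  have hz : (v a : ℂ) * conj (v a : ℂ) = 1 := by
    rw [Complex.mul_conj, Circle.normSq_coe, Complex.ofReal_one]
  rw [G.bondVar_eq_mul_bondChar, G.bondVar_eq_mul_bondChar, map_mul, map_mul, map_inv,
    Pi.one_apply, one_mul]
  simp only [Circle.coe_mul, Circle.coe_inv_eq_conj, mmpCos]
  set P : ℂ := ((G.bondChar a φ : Circle) : ℂ)
  set Q : ℂ := ((G.bondChar a ψ : Circle) : ℂ)
  have e1 : P * conj Q = ((v a : ℂ) * P) * conj ((v a : ℂ) * Q) := by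
    rw [map_mul]
    linear_combination (-(P * conj Q)) * hz
  have e2 : (v a : ℂ) * (v a) * (P * Q) = ((v a : ℂ) * P) * ((v a : ℂ) * Q) := by ring
  rw [e1, e2, key]

/-- The MMP kernel `2 Im χ₀(φ) Im χ₀(ψ) exp (β · 2 ∑_a k_a(φ) k_a(ψ))`, the pull-back under the
duplication map of `(Re χ₀(θ) − Re χ₀(θ')) w_1(θ) w_u(θ')`.
[cite: GarbanSpencer2022, Appendix, proof of Theorem 7.1] -/
def mmpKernel (β : ℝ) (v : ι → Circle) (χ₀ : (V → Circle) →ₜ* Circle)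
    (p : (V → Circle) × (V → Circle)) : ℝ :=
  2 * (imChar χ₀ p.1 * imChar χ₀ p.2) * Real.exp (β * (2 * ∑ a, G.mmpCos v a p.1 * G.mmpCos v a p.2))

/-- **Pull-back of the duplicated difference**: for `θ = φψ⁻¹`, `θ' = φψ`, `u = v²`,
`(Re χ₀(θ) − Re χ₀(θ')) · w_u(θ') · w_1(θ) = mmpKernel (φ, ψ)`.
[cite: GarbanSpencer2022, Appendix, proof of Theorem 7.1] -/
theorem mmp_key (β : ℝ) (v : ι → Circle) (χ₀ : (V → Circle) →ₜ* Circle) (φ ψ : V → Circle) :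
    (reChar χ₀ (φ * ψ⁻¹) - reChar χ₀ (φ * ψ)) *
        (G.weight β (fun a => v a * v a) (φ * ψ) * G.weight β 1 (φ * ψ⁻¹)) =
      G.mmpKernel β v χ₀ (φ, ψ) := by
  have h1 : reChar χ₀ (φ * ψ⁻¹) - reChar χ₀ (φ * ψ) = 2 * (imChar χ₀ φ * imChar χ₀ ψ) := by
    have := reChar_mul_sub_reChar_mul_inv χ₀ φ ψ; linarith
  rw [h1, mmpKernel, weight, weight, ← Real.exp_add, ← mul_add, add_comm, mmp_exponent]

/-- Truncations of the MMP kernel (the exponential replaced by its Taylor polynomial): positive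
kernels. [folklore] -/
theorem isPosKernel_mmpTrunc {β : ℝ} (hβ : 0 ≤ β) (v : ι → Circle) (χ₀ : (V → Circle) →ₜ* Circle)
    (N : ℕ) : IsPosKernel fun p : (V → Circle) × (V → Circle) =>
      2 * (imChar χ₀ p.1 * imChar χ₀ p.2) *
        expTrunc N (β * (2 * ∑ a, G.mmpCos v a p.1 * G.mmpCos v a p.2)) := by
  have h1 : IsPosKernel fun p : (V → Circle) × (V → Circle) => 2 * (imChar χ₀ p.1 * imChar χ₀ p.2) :=
    (isPosKernel_mul_self (continuous_imChar χ₀)).const_mul zero_le_two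
  have h2 : IsPosKernel fun p : (V → Circle) × (V → Circle) =>
      β * (2 * ∑ a, G.mmpCos v a p.1 * G.mmpCos v a p.2) := by
    have : (fun p : (V → Circle) × (V → Circle) => β * (2 * ∑ a, G.mmpCos v a p.1 * G.mmpCos v a p.2)) =
        fun p => (β * 2) * (∑ a, fun q : (V → Circle) × (V → Circle) =>
          G.mmpCos v a q.1 * G.mmpCos v a q.2) p := by
      funext p; simp only [Finset.sum_apply, mul_assoc]
    rw [this]
    exact (IsPosKernel.sum fun a _ => isPosKernel_mul_self (G.continuous_mmpCos v a)).const_mul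
      (by positivity)
  exact h1.mul (h2.comp_expTrunc N)

/-- The exponent of the MMP kernel is bounded by `|β| · 2|ι|`. [folklore] -/
theorem abs_mmp_exponent_le (β : ℝ) (v : ι → Circle) (p : (V → Circle) × (V → Circle)) :
    |β * (2 * ∑ a, G.mmpCos v a p.1 * G.mmpCos v a p.2)| ≤ |β| * (2 * Fintype.card ι) := by
  rw [abs_mul]
  refine mul_le_mul_of_nonneg_left ?_ (abs_nonneg β)
  rw [abs_mul, abs_two]
  refine mul_le_mul_of_nonneg_left ((Finset.abs_sum_le_sum_abs _ _).trans ?_) zero_le_two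
  calc ∑ a, |G.mmpCos v a p.1 * G.mmpCos v a p.2| ≤ ∑ _a : ι, (1 : ℝ) :=
        Finset.sum_le_sum fun a _ => by
          rw [abs_mul]
          exact mul_le_one₀ (G.abs_mmpCos_le_one v a _) (abs_nonneg _) (G.abs_mmpCos_le_one v a _)
    _ = Fintype.card ι := by simp

variable [Fintype V] [MeasurableSpace Circle] [BorelSpace Circle]

/-- **Positivity of the MMP integral**: `∫∫ mmpKernel d(dφ ⊗ dψ) ≥ 0` (`β ≥ 0`): dominated limit of
the integrals of its truncations, each the integral of a positive kernel.
[cite: GarbanSpencer2022, Appendix, proof of Theorem 7.1] -/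
theorem integral_mmpKernel_nonneg {β : ℝ} (hβ : 0 ≤ β) (v : ι → Circle)
    (χ₀ : (V → Circle) →ₜ* Circle) :
    0 ≤ ∫ p, G.mmpKernel β v χ₀ p ∂((torusHaar V).prod (torusHaar V)) := by
  set T : ℕ → (V → Circle) × (V → Circle) → ℝ := fun N p =>
    2 * (imChar χ₀ p.1 * imChar χ₀ p.2) *
      expTrunc N (β * (2 * ∑ a, G.mmpCos v a p.1 * G.mmpCos v a p.2)) with hT
  have hpos : ∀ N, IsPosKernel (T N) := fun N => G.isPosKernel_mmpTrunc hβ v χ₀ N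
  have hlim : Tendsto (fun N => ∫ p, T N p ∂((torusHaar V).prod (torusHaar V))) atTop
      (𝓝 (∫ p, G.mmpKernel β v χ₀ p ∂((torusHaar V).prod (torusHaar V)))) := by
    refine tendsto_integral_of_dominated_convergence
      (fun _ => 2 * Real.exp (|β| * (2 * Fintype.card ι))) ?_ (integrable_const _) ?_ ?_
    · exact fun N => (hpos N).continuous.aestronglyMeasurable
    · refine fun N => ae_of_all _ fun p => ?_
      rw [Real.norm_eq_abs, hT]
      dsimp only
      rw [abs_mul, abs_mul, abs_two]
      refine mul_le_mul (mul_le_of_le_one_right zero_le_two ?_)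
        (abs_expTrunc_le (G.abs_mmp_exponent_le β v p) N) (abs_nonneg _) zero_le_two
      rw [abs_mul]
      exact mul_le_one₀ (abs_imChar_le_one χ₀ _) (abs_nonneg _) (abs_imChar_le_one χ₀ _)
    · refine ae_of_all _ fun p => ?_
      exact (tendsto_expTrunc _).const_mul _
  exact ge_of_tendsto' hlim fun N => (hpos N).integral_nonneg _

/-! ### The inequality -/

/-- Fubini form of the duplicated difference:
`∫∫ (f(θ) − f(θ')) w'(θ') w(θ) = (∫ w')(∫ f w) − (∫ f w')(∫ w)`. [folklore] -/
theorem integral_sub_mul_mul {f w w' : (V → Circle) → ℝ} (hf : Continuous f) (hw : Continuous w)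
    (hw' : Continuous w') :
    ∫ p, (f p.2 - f p.1) * (w' p.1 * w p.2) ∂((torusHaar V).prod (torusHaar V)) =
      (∫ θ, w' θ ∂torusHaar V) * (∫ θ, f θ * w θ ∂torusHaar V) -
        (∫ θ, f θ * w' θ ∂torusHaar V) * (∫ θ, w θ ∂torusHaar V) := by
  have e : ∀ p : (V → Circle) × (V → Circle), (f p.2 - f p.1) * (w' p.1 * w p.2) =
      w' p.1 * (f p.2 * w p.2) - (f p.1 * w' p.1) * w p.2 := fun p => by ring
  simp_rw [e]
  have i1 : Integrable (fun p : (V → Circle) × (V → Circle) => w' p.1 * (f p.2 * w p.2))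
      ((torusHaar V).prod (torusHaar V)) :=
    integrable_of_continuous_compactSpace _ (by fun_prop)
  have i2 : Integrable (fun p : (V → Circle) × (V → Circle) => (f p.1 * w' p.1) * w p.2)
      ((torusHaar V).prod (torusHaar V)) :=
    integrable_of_continuous_compactSpace _ (by fun_prop)
  rw [integral_sub i1 i2,
    integral_prod_mul (μ := torusHaar V) (ν := torusHaar V) w' (fun θ => f θ * w θ),
    integral_prod_mul (μ := torusHaar V) (ν := torusHaar V) (fun θ => f θ * w' θ) w]

/-- **Messager–Miracle-Solé–Pfister inequality (character form).** For the XY model with bond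
phases `u` on a finite bond system at `β ≥ 0` and every continuous unitary character `χ₀` of the
torus, `⟨Re χ₀⟩_{u,β} ≤ ⟨Re χ₀⟩_{1,β}`: quenched phases lower the correlations
(Garban–Spencer 2022, Appendix Thm. 7.1, after Messager–Miracle-Solé–Pfister 1978).
[cite: GarbanSpencer2022, Remark 1 and Appendix Theorem 7.1] -/
theorem expect_reChar_le_expect_one {β : ℝ} (hβ : 0 ≤ β) (u : ι → Circle)
    (χ₀ : (V → Circle) →ₜ* Circle) :
    G.expect β u (reChar χ₀) ≤ G.expect β 1 (reChar χ₀) := by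
  -- square roots of the phases
  set v : ι → Circle := fun a => Circle.exp (Complex.arg (u a : ℂ) / 2) with hv
  have huv : (fun a => v a * v a) = u := by
    funext a; rw [hv, ← Circle.exp_add, add_halves, Circle.exp_arg]
  rw [← huv]
  set u' : ι → Circle := fun a => v a * v a
  have hf := continuous_reChar χ₀
  have hw1 := G.continuous_weight β 1
  have hwu := G.continuous_weight β u'
  have hZ1 := G.partitionFn_pos β 1
  have hZu := G.partitionFn_pos β u'
  unfold expect
  rw [div_le_div_iff₀ hZu hZ1]
  -- the duplicated difference is the integral of the MMP kernel
  have hdup := integral_sub_mul_mul (V := V) hf hw1 hwu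
  have hcont : Continuous fun p : (V → Circle) × (V → Circle) =>
      (reChar χ₀ p.2 - reChar χ₀ p.1) * (G.weight β u' p.1 * G.weight β 1 p.2) := by fun_prop
  have hcv := integral_comp_dupHom (torusHaar V) surjective_mul_self_torus hcont
  simp only [dupHom_apply] at hcv
  have hI : ∫ p : (V → Circle) × (V → Circle), (reChar χ₀ (p.1 * p.2⁻¹) - reChar χ₀ (p.1 * p.2)) *
        (G.weight β u' (p.1 * p.2) * G.weight β 1 (p.1 * p.2⁻¹)) ∂((torusHaar V).prod (torusHaar V)) =
      ∫ p, G.mmpKernel β v χ₀ p ∂((torusHaar V).prod (torusHaar V)) :=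
    integral_congr_ae (ae_of_all _ fun p => G.mmp_key β v χ₀ p.1 p.2)
  have hpos := G.integral_mmpKernel_nonneg hβ v χ₀
  rw [← hI, hcv, hdup] at hpos
  have : (∫ θ, reChar χ₀ θ * G.weight β u' θ ∂torusHaar V) * G.partitionFn β 1 ≤
      G.partitionFn β u' * ∫ θ, reChar χ₀ θ * G.weight β 1 θ ∂torusHaar V := by
    unfold partitionFn; linarith
  linarith [this]

/-- **Messager–Miracle-Solé–Pfister inequality (Garban–Spencer 2022, Remark 1):**
`⟨cos(θ(x) − θ(y))⟩_{ω,β,Λ} ≤ ⟨cos(θ(x) − θ(y))⟩_{ω=0,β,Λ}` for every choice of bond phases — the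
pure XY model dominates every phase-disordered one, "hence Theorem 1.3 implies long range order
without disorder". [cite: GarbanSpencer2022, Remark 1 and Appendix Theorem 7.1] -/
theorem expect_cosDiff_le_expect_one {β : ℝ} (hβ : 0 ≤ β) (u : ι → Circle) (x y : V) :
    G.expect β u (cosDiff x y) ≤ G.expect β 1 (cosDiff x y) := by
  have h := G.expect_reChar_le_expect_one hβ u (diffChar x y)
  have e : (cosDiff x y : (V → Circle) → ℝ) = reChar (diffChar x y) :=
    funext fun θ => cosDiff_eq_reChar x y θ
  rwa [← e] at h

end Exponent

end BondSystem

end Literature.Probability.LatticeModels
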